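import Summits.HodgeConjecture.HodgeConjecture.Theorems.F0P3cStCharTSAdRegularisedDescent   -- ★ p851844 (LH6-p02) C7: generic `det_eq_prod_of_eq_conj_diagonal`, descent kit `comp_adSubOne_transport`, `apply_eq_self_transport`, `det_toLin_map_toMatrix`
import Summits.HodgeConjecture.HodgeConjecture.Theorems.F0P3cStCharTSJacCartanWeight          -- ★ p852323 (this seat) WEIGHT-DOCK file 1: `addEquivAddHaarChar_sq_eq_normAbs_det` (any `n`)
import HarnessLib

/-!
# F0 · P3c · line LH6 «StCharTS» — ROAD «UP-TR» prep (H4) «JAC-H», rank one: C7 AT `N = 2` — `det Φ = −disc(χ_t) ∕ det(t)` for the regularised Jacobian operator of a regular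
# semisimple `t ∈ GL₂(K)` (Harish-Chandra 1970, Lemma 22; Rogawski 1990, §4.9 p. 54)

Cell `pub/hodgecm-mathlib`, crux H413 = `stmt-HodgeConjecture-24833` (lane `--supports … --as helper`), route HCCMUnconditional; seat LH6-p04 (g7), UP-TR (H4)-compact prep
(CENSUS-UPTR v1 `F0/P3/F0P3-p02/g23/CENSUS-UPTR.v1.F0P3p02g23.md` §3 (H4): tube Jacobians on the `H`-Cartans, `H = U(Φ₂) × U(Φ₁)`; bus F0∕P3b 2026-09-02T18:2xZ).  THEOREMS ONLY (no
definition ∕ instance ∕ notation ∕ named fact ∕ `sorry`); ★-only imports.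

WHAT.  The `N = 2` twin of ★ C7 (`F0P3cStCharTSAdRegularisedDet` ∕ `…Descent`, LH6-p02): for `t ∈ GL₂(K)` with separable characteristic polynomial and ANY `K`-linear
`Φ : M₂(K) → M₂(K)` with `Φ ∘ (Ad_t − 1) = (Ad_{t⁻¹} − 1) ∘ (Ad_t − 1)` and `Φ = id` on the commutant of `t` (the regularised Jacobian operator of the tube map at `t`),
**`det Φ = −disc(χ_t) ∕ det(t)`** (`= ∏_{i ≠ j}(λᵢ⁻¹λⱼ − 1) = (λ₀⁻¹λ₁ − 1)(λ₁⁻¹λ₀ − 1) = −(λ₀ − λ₁)² ∕ (λ₀λ₁)`).  §1 the scalar identity and the split case (★ generic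
`det_eq_prod_of_eq_conj_diagonal` at `Fin 2`; Mathlib `discr_of_degree_eq_two`, `charpoly_diagonal`); §2 a regular `2 × 2` matrix with split separable characteristic polynomial
is `g · diag(d) · g⁻¹` (★ `exists_conj_eq_of_minpoly_eq_charpoly`, as in ★ C7's `Fin 3` case); §3 `disc` of a quadratic commutes with ring maps and the descent from `K̄` (★ C7's
transport kit verbatim).  CONSUMER: with ★ WEIGHT-DOCK file 1 `…JacCartanWeight.addEquivAddHaarChar_sq_eq_normAbs_det` (any `n`) this gives the `H`-side Jacobian character
`addEquivAddHaarChar L = √‖disc(χ_s) ∕ det(s)‖_{L_w} = (𝔇.DH s)²` (eDH's radicand) needed by ★ C8b-model `tubeJacobianLocal_elliptic_model` (generic `N`) at `N = 2` — the compact half of (H4).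
HONEST LABEL: count-neutral linear algebra; closes no organ; HC_CM is proved only modulo the 7 printed citations (2 remaining: hLiu418 = `stmt-HodgeConjecture-24832`, h413 =
`stmt-HodgeConjecture-24833`) until rung 0 closes.

## References
* [HarishChandra1970] Harish-Chandra, *Harmonic analysis on reductive p-adic groups*, LNM 162 (1970), Lemma 22 (the Jacobian `|det((1 − Ad t)|_{𝔤∕𝔱})|`).
* [Rogawski1990] J. D. Rogawski, *Automorphic Representations of Unitary Groups in Three Variables*, Ann. of Math. Stud. 123 (1990), §4.9 p. 54 (`D_H` «defined similarly»), §12.5 p. 182.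
* [HornJohnson2013] R. A. Horn, C. R. Johnson, *Matrix Analysis* (2nd ed., 2013), Thm 3.2.4.2 (nonderogatory matrices and their commutant).
-/

set_option autoImplicit false
-- the mandated namespace has the single-problem summit's repeated segment (`HodgeConjecture.HodgeConjecture`)
set_option linter.dupNamespace false

noncomputable section

open Matrix Polynomial
open scoped MatrixGroups
open Summit.HodgeConjecture.HodgeConjecture.Cruxes.H413.F0P3cStCharTSAdRegularisedDet
open Summit.HodgeConjecture.HodgeConjecture.Cruxes.H413.F0P3cStCharTSAdRegularisedDescent

namespace Summit.HodgeConjecture.HodgeConjecture.Cruxes.H413.F0P3cStCharTSAdRegularisedDetTwo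

/-! ## §1 The scalar identity and the split case at `Fin 2` -/

section Split

variable {K : Type*} [Field K]

/-- **The `Fin 2` scalar identity**: `∏_{(k,l)} (d_k⁻¹ d_l − 1 + [k = l]) = −(d₀ − d₁)² ∕ (d₀ d₁)`. [cite: HarishChandra1970, Lemma 22] [cite: Rogawski1990, §4.9 p. 54] -/
theorem prod_phi_eigenvalues_fin_two (d : Fin 2 → Kˣ) :
    (∏ p : Fin 2 × Fin 2, ((((d p.1)⁻¹ * d p.2 : Kˣ) : K) - 1 + if p.1 = p.2 then 1 else 0)) =
      -(((d 0 : K) - d 1)) ^ 2 / ((d 0 : K) * d 1) := by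
  have h0 : ((d 0 : Kˣ) : K) ≠ 0 := (d 0).ne_zero
  have h1 : ((d 1 : Kˣ) : K) ≠ 0 := (d 1).ne_zero
  rw [Fintype.prod_prod_type]
  simp only [Fin.prod_univ_two, Units.val_mul, Units.val_inv_eq_inv_val]
  have e01 : ((0 : Fin 2) = 1) = False := by decide
  have e10 : ((1 : Fin 2) = 0) = False := by decide
  simp only [e01, e10, if_true, if_false, add_zero]
  field_simp
  ring

/-- **Discriminant and determinant of a `2 × 2` diagonal matrix**: `disc(χ_{diag(d)}) = (d₀ − d₁)²`, `det = d₀ d₁` (Mathlib `charpoly_diagonal`, `discr_of_degree_eq_two`). [folklore] -/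
theorem discr_charpoly_and_det_diagonal_fin_two (d : Fin 2 → K) :
    (diagonal d).charpoly.discr = (d 0 - d 1) ^ 2 ∧ (diagonal d).det = d 0 * d 1 := by
  have hχ : (diagonal d).charpoly = X ^ 2 - C (d 0 + d 1) * X + C (d 0 * d 1) := by
    rw [Matrix.charpoly_diagonal, Fin.prod_univ_two]
    simp only [map_add, map_mul]
    ring
  have hdeg : (diagonal d).charpoly.degree = 2 := by
    rw [Matrix.charpoly_degree_eq_dim, Fintype.card_fin]; rfl
  refine ⟨?_, by rw [Matrix.det_diagonal, Fin.prod_univ_two]⟩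
  rw [Polynomial.discr_of_degree_eq_two hdeg, hχ]
  simp only [coeff_add, coeff_sub, coeff_X_pow, coeff_C_mul, coeff_X, coeff_C]
  norm_num
  ring

/-- **C7 AT `N = 2`, SPLIT CASE: `det Φ = −disc(χ_t) ∕ det(t)`** for `t = g · diag(d) · g⁻¹ ∈ GL₂(K)` with `d₀ ≠ d₁` and any regularised Jacobian operator `Φ`
(`Ad_{t⁻¹} − 1` on `(Ad_t − 1)M₂(K)`, identity on `𝔷(t)`) — ★ generic `det_eq_prod_of_eq_conj_diagonal` + §1. [cite: HarishChandra1970, Lemma 22] [cite: Rogawski1990, §4.9 p. 54; §12.5 p. 182] -/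
theorem det_eq_neg_discr_div_det_of_eq_conj_diagonal (t g : GL (Fin 2) K) (d : Fin 2 → Kˣ) (hd : Function.Injective d)
    (ht : (t : Matrix (Fin 2) (Fin 2) K) = (g : Matrix (Fin 2) (Fin 2) K) * diagonal (fun i => ((d i : Kˣ) : K)) * ((g⁻¹ : GL (Fin 2) K) : Matrix (Fin 2) (Fin 2) K))
    (Φ : Matrix (Fin 2) (Fin 2) K →ₗ[K] Matrix (Fin 2) (Fin 2) K)
    (h1 : Φ ∘ₗ (LinearMap.mulLeftRight K ((t : Matrix (Fin 2) (Fin 2) K), ((t⁻¹ : GL (Fin 2) K) : Matrix (Fin 2) (Fin 2) K)) - LinearMap.id) =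
      (LinearMap.mulLeftRight K (((t⁻¹ : GL (Fin 2) K) : Matrix (Fin 2) (Fin 2) K), (t : Matrix (Fin 2) (Fin 2) K)) - LinearMap.id) ∘ₗ
        (LinearMap.mulLeftRight K ((t : Matrix (Fin 2) (Fin 2) K), ((t⁻¹ : GL (Fin 2) K) : Matrix (Fin 2) (Fin 2) K)) - LinearMap.id))
    (h2 : ∀ Z : Matrix (Fin 2) (Fin 2) K, Z * (t : Matrix (Fin 2) (Fin 2) K) = (t : Matrix (Fin 2) (Fin 2) K) * Z → Φ Z = Z) :
    LinearMap.det Φ = -((t : Matrix (Fin 2) (Fin 2) K).charpoly.discr) / (t : Matrix (Fin 2) (Fin 2) K).det := by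
  obtain ⟨hdisc, hdet⟩ := discr_charpoly_and_det_diagonal_fin_two (fun i => ((d i : Kˣ) : K))
  have hch : (t : Matrix (Fin 2) (Fin 2) K).charpoly = (diagonal fun i => ((d i : Kˣ) : K)).charpoly := by
    rw [ht, Matrix.coe_units_inv]; exact Matrix.charpoly_units_conj g _
  have hdt : (t : Matrix (Fin 2) (Fin 2) K).det = (diagonal fun i => ((d i : Kˣ) : K)).det := by
    rw [ht, Matrix.coe_units_inv]; exact Matrix.det_conj g.isUnit _
  rw [det_eq_prod_of_eq_conj_diagonal t g d hd ht Φ h1 h2, prod_phi_eigenvalues_fin_two, hch, hdt, hdisc, hdet]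

end Split

/-! ## §2 A regular `2 × 2` matrix with split separable characteristic polynomial is conjugate to a regular diagonal matrix -/

/-- A `2 × 2` invertible matrix over a field `E` whose characteristic polynomial is separable and splits is `g · diag(d) · g⁻¹` with `d₀ ≠ d₁` non-zero (the roots; conjugation
by ★ `exists_conj_eq_of_minpoly_eq_charpoly`, both sides being nonderogatory). [cite: HornJohnson2013, Thm 3.2.4.2] -/
theorem exists_eq_conj_diagonal_of_splits_fin_two {E : Type*} [Field E] (t : GL (Fin 2) E)
    (hsep : (t : Matrix (Fin 2) (Fin 2) E).charpoly.Separable) (hspl : (t : Matrix (Fin 2) (Fin 2) E).charpoly.Splits) :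
    ∃ (g : GL (Fin 2) E) (d : Fin 2 → Eˣ), Function.Injective d ∧
      (t : Matrix (Fin 2) (Fin 2) E) = (g : Matrix (Fin 2) (Fin 2) E) * diagonal (fun i => ((d i : Eˣ) : E)) * ((g⁻¹ : GL (Fin 2) E) : Matrix (Fin 2) (Fin 2) E) := by
  classical
  set χ := (t : Matrix (Fin 2) (Fin 2) E).charpoly with hχ
  have hmon : χ.Monic := Matrix.charpoly_monic _
  have hdeg : χ.natDegree = 2 := by rw [hχ, Matrix.charpoly_natDegree_eq_dim, Fintype.card_fin]
  have hcard : χ.roots.card = 2 := by rw [← hspl.natDegree_eq_card_roots, hdeg]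
  obtain ⟨a, b, hs⟩ := Multiset.card_eq_two.1 hcard
  have hnd : χ.roots.Nodup := Polynomial.nodup_roots hsep
  rw [hs] at hnd
  have hab : a ≠ b := fun h => (Multiset.nodup_cons.1 hnd).1 (h ▸ Multiset.mem_singleton_self _)
  -- the roots are non-zero (`det t ≠ 0`)
  have hdt : (t : Matrix (Fin 2) (Fin 2) E).det ≠ 0 := ((Matrix.isUnit_iff_isUnit_det _).1 t.isUnit).ne_zero
  have hroot : ∀ r ∈ χ.roots, r ≠ 0 := by
    intro r hr h0
    subst h0
    have h := (Polynomial.mem_roots hmon.ne_zero).1 hr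
    rw [Polynomial.IsRoot.def, ← Polynomial.coeff_zero_eq_eval_zero] at h
    apply hdt
    rw [Matrix.det_eq_sign_charpoly_coeff, ← hχ, h, mul_zero]
  have ha : a ≠ 0 := hroot a (by rw [hs]; exact Multiset.mem_cons_self _ _)
  have hb : b ≠ 0 := hroot b (by rw [hs]; exact Multiset.mem_cons.2 (Or.inr (Multiset.mem_singleton_self _)))
  -- the diagonal of the roots
  let d : Fin 2 → Eˣ := ![Units.mk0 a ha, Units.mk0 b hb]
  have hd0 : ((d 0 : Eˣ) : E) = a := rfl
  have hd1 : ((d 1 : Eˣ) : E) = b := rfl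
  have hdinj : Function.Injective d := by
    intro i j hij
    have hv : ((d i : Eˣ) : E) = ((d j : Eˣ) : E) := by rw [hij]
    fin_cases i <;> fin_cases j <;> first | rfl | (exfalso; first | exact hab hv | exact hab hv.symm)
  set D : Matrix (Fin 2) (Fin 2) E := diagonal (fun i => ((d i : Eˣ) : E)) with hD
  -- `χ_D = χ_t`
  have hχD : D.charpoly = χ := by
    rw [hD, Matrix.charpoly_diagonal, Fin.prod_univ_two, hd0, hd1,
      ← Polynomial.prod_multiset_X_sub_C_of_monic_of_roots_card_eq hmon (by rw [hcard, hdeg]), hs]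
    simp only [Multiset.insert_eq_cons, Multiset.map_cons, Multiset.map_singleton, Multiset.prod_cons, Multiset.prod_singleton]
  have hsepD : D.charpoly.Separable := by rw [hχD]; exact hsep
  obtain ⟨S, hS, hSD⟩ := Literature.LinearAlgebra.Matrix.exists_conj_eq_of_minpoly_eq_charpoly (t : Matrix (Fin 2) (Fin 2) E) D
    (Literature.LinearAlgebra.Matrix.minpoly_eq_charpoly_of_charpoly_separable _ hsep)
    (Literature.LinearAlgebra.Matrix.minpoly_eq_charpoly_of_charpoly_separable _ hsepD) hχD.symm
  -- `t = S · D · S⁻¹`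
  refine ⟨Matrix.GeneralLinearGroup.mk'' S hS, d, hdinj, ?_⟩
  have hSv : ((Matrix.GeneralLinearGroup.mk'' S hS : GL (Fin 2) E) : Matrix (Fin 2) (Fin 2) E) = S := rfl
  rw [Matrix.coe_units_inv, hSv, ← hD, hSD]
  symm
  calc S * (S⁻¹ * (t : Matrix (Fin 2) (Fin 2) E) * S) * S⁻¹ = S * (S⁻¹ * ((t : Matrix (Fin 2) (Fin 2) E) * (S * S⁻¹))) := by
        simp only [Matrix.mul_assoc]
    _ = (t : Matrix (Fin 2) (Fin 2) E) := by
        rw [Matrix.mul_nonsing_inv S hS, Matrix.mul_one, ← Matrix.mul_assoc, Matrix.mul_nonsing_inv S hS, Matrix.one_mul]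

/-! ## §3 The discriminant of a quadratic commutes with ring maps; the K-level identity -/

section Descent

variable {K K' : Type*} [Field K] [Field K'] [Algebra K K']

/-- `disc(f.map φ) = φ(disc f)` for a quadratic over a field (Mathlib's explicit formula `discr_of_degree_eq_two`). [folklore] -/
theorem discr_map_of_degree_eq_two (f : K[X]) (hf : f.degree = 2) :
    (f.map (algebraMap K K')).discr = algebraMap K K' f.discr := by
  have hf' : (f.map (algebraMap K K')).degree = 2 := by rw [Polynomial.degree_map]; exact hf
  rw [Polynomial.discr_of_degree_eq_two hf, Polynomial.discr_of_degree_eq_two hf']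
  simp only [Polynomial.coeff_map, map_sub, map_mul, map_pow, map_ofNat]

end Descent

/-- **C7 AT `N = 2`, K-LEVEL, GENERAL REGULAR SEMISIMPLE `t ∈ GL₂(K)`** (`χ_t` separable; eigenvalues anywhere): every `K`-linear operator `Φ` on `M₂(K)` with
`Φ ∘ (Ad_t − 1) = (Ad_{t⁻¹} − 1) ∘ (Ad_t − 1)` and `Φ = id` on the commutant of `t` has **`det Φ = −disc(χ_t) ∕ det(t)`** — by transport to `K̄` (★ C7's kit
`comp_adSubOne_transport`, `apply_eq_self_transport`, `det_toLin_map_toMatrix`), where `t` is `g·diag(d)·g⁻¹` (§2) and §1 applies, and injectivity of `K → K̄`.  With ★ WEIGHT-DOCK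
file 1 (`χ(L)² = ‖det_K Φ‖_K`, any `n`) this is the rank-one (`H`-side) tube-Jacobian weight `‖disc(χ_s) ∕ det s‖ = (D_H s)⁴`. [cite: HarishChandra1970, Lemma 22] [cite: Rogawski1990, §4.9 p. 54; §12.5 p. 182] -/
theorem det_eq_neg_discr_div_det {K : Type*} [Field K] (t : GL (Fin 2) K) (hsep : (t : Matrix (Fin 2) (Fin 2) K).charpoly.Separable)
    (Φ : Matrix (Fin 2) (Fin 2) K →ₗ[K] Matrix (Fin 2) (Fin 2) K)
    (h1 : Φ ∘ₗ (LinearMap.mulLeftRight K ((t : Matrix (Fin 2) (Fin 2) K), ((t⁻¹ : GL (Fin 2) K) : Matrix (Fin 2) (Fin 2) K)) - LinearMap.id) =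
      (LinearMap.mulLeftRight K (((t⁻¹ : GL (Fin 2) K) : Matrix (Fin 2) (Fin 2) K), (t : Matrix (Fin 2) (Fin 2) K)) - LinearMap.id) ∘ₗ
        (LinearMap.mulLeftRight K ((t : Matrix (Fin 2) (Fin 2) K), ((t⁻¹ : GL (Fin 2) K) : Matrix (Fin 2) (Fin 2) K)) - LinearMap.id))
    (h2 : ∀ Z : Matrix (Fin 2) (Fin 2) K, Z * (t : Matrix (Fin 2) (Fin 2) K) = (t : Matrix (Fin 2) (Fin 2) K) * Z → Φ Z = Z) :
    LinearMap.det Φ = -((t : Matrix (Fin 2) (Fin 2) K).charpoly.discr) / (t : Matrix (Fin 2) (Fin 2) K).det := by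
  classical
  -- transport everything to `K̄`
  let K' := AlgebraicClosure K
  let ι : K →+* K' := algebraMap K K'
  have htti : (t : Matrix (Fin 2) (Fin 2) K).map ι * ((t⁻¹ : GL (Fin 2) K) : Matrix (Fin 2) (Fin 2) K).map ι = 1 := by
    rw [← Matrix.map_mul, ← Units.val_mul, mul_inv_cancel, Units.val_one, Matrix.map_one _ (map_zero ι) (map_one ι)]
  have htit : ((t⁻¹ : GL (Fin 2) K) : Matrix (Fin 2) (Fin 2) K).map ι * (t : Matrix (Fin 2) (Fin 2) K).map ι = 1 := by
    rw [← Matrix.map_mul, ← Units.val_mul, inv_mul_cancel, Units.val_one, Matrix.map_one _ (map_zero ι) (map_one ι)]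
  let t' : GL (Fin 2) K' := ⟨(t : Matrix (Fin 2) (Fin 2) K).map ι, ((t⁻¹ : GL (Fin 2) K) : Matrix (Fin 2) (Fin 2) K).map ι, htti, htit⟩
  have ht' : (t' : Matrix (Fin 2) (Fin 2) K') = (t : Matrix (Fin 2) (Fin 2) K).map ι := rfl
  have ht'i : ((t'⁻¹ : GL (Fin 2) K') : Matrix (Fin 2) (Fin 2) K') = ((t⁻¹ : GL (Fin 2) K) : Matrix (Fin 2) (Fin 2) K).map ι := rfl
  set Φ' : Matrix (Fin 2) (Fin 2) K' →ₗ[K'] Matrix (Fin 2) (Fin 2) K' := Matrix.toLin (Matrix.stdBasis K' (Fin 2) (Fin 2)) (Matrix.stdBasis K' (Fin 2) (Fin 2))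
      ((LinearMap.toMatrix (Matrix.stdBasis K (Fin 2) (Fin 2)) (Matrix.stdBasis K (Fin 2) (Fin 2)) Φ).map ι) with hΦ'
  have h1' := comp_adSubOne_transport (K' := K') t t' ht' ht'i Φ h1
  have h2' : ∀ Z' : Matrix (Fin 2) (Fin 2) K', Z' * (t' : Matrix (Fin 2) (Fin 2) K') = (t' : Matrix (Fin 2) (Fin 2) K') * Z' → Φ' Z' = Z' :=
    fun Z' hZ' => apply_eq_self_transport (K' := K') (t : Matrix (Fin 2) (Fin 2) K) hsep Φ h2 Z' hZ'
  -- `χ_{t'} = χ_t.map ι` is separable and splits in `K̄`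
  have hχ' : (t' : Matrix (Fin 2) (Fin 2) K').charpoly = (t : Matrix (Fin 2) (Fin 2) K).charpoly.map ι := by
    rw [ht', Matrix.charpoly_map]
  have hsep' : (t' : Matrix (Fin 2) (Fin 2) K').charpoly.Separable := by rw [hχ']; exact hsep.map
  have hspl' : (t' : Matrix (Fin 2) (Fin 2) K').charpoly.Splits := IsAlgClosed.splits _
  obtain ⟨g, d, hd, htd⟩ := exists_eq_conj_diagonal_of_splits_fin_two t' hsep' hspl'
  -- the split case over `K̄`
  have hdet' := det_eq_neg_discr_div_det_of_eq_conj_diagonal t' g d hd htd Φ' h1' h2'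
  -- read it back in `K`
  have hdeg : (t : Matrix (Fin 2) (Fin 2) K).charpoly.degree = 2 := by
    rw [Polynomial.degree_eq_natDegree (Matrix.charpoly_monic _).ne_zero, Matrix.charpoly_natDegree_eq_dim, Fintype.card_fin]; rfl
  rw [hΦ', det_toLin_map_toMatrix, hχ', discr_map_of_degree_eq_two _ hdeg, ht', ← RingHom.mapMatrix_apply, ← RingHom.map_det,
    ← map_neg, ← map_div₀] at hdet'
  exact ι.injective hdet'

/-! ## §4 The rank-one Jacobian character: `χ(L) = √‖−disc(χ_{t₀}) ∕ det(t₀)‖_K` on `𝔲(σ, J) ⊂ M₂(K)` -/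

section Weight

variable {K : Type*} [Field K] [ValuativeRel K] [TopologicalSpace K] [IsNonarchimedeanLocalField K] [CharZero K] [SecondCountableTopology K]

/-- **THE JACOBIAN CHARACTER OF THE CARTAN LINEAR PART, `n = 2`: `addEquivAddHaarChar L = √‖−disc(χ_{t₀}) ∕ det(t₀)‖_K`** — ★ WEIGHT-DOCK file 1
`addEquivAddHaarChar_sq_eq_normAbs_det` (any `n`) + §3 `det_eq_neg_discr_div_det` (the companion `Φ` exists by ★ (Q8) `exists_cartanLinearPart` over the fixed field).  This is the `hDval`
value of ★ C8b-model `tubeJacobianLocal_elliptic_model` at `N = 2` (the compact Cartans of `U(Φ₂)(L⁺_v)`, hence of `H_v = U(Φ₂) × U(Φ₁)`), i.e. `(D_H)²` in eDH's radicand.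
[cite: HarishChandra1970, Lemma 22] [cite: Rogawski1990, §4.9 p. 54; §12.5 p. 182] -/
theorem addEquivAddHaarChar_eq_sqrt_normAbs_fin_two (σ : K →+* K) (hσc : Continuous σ) (hσ2 : ∀ a, σ (σ a) = a) (hσne : ∃ a, σ a ≠ a)
    (J : Matrix (Fin 2) (Fin 2) K) (hJ : IsUnit J.det) (hJh : (J.map σ)ᵀ = J)
    (t₀ : GL (Fin 2) K) (ht₀ : ((t₀ : Matrix (Fin 2) (Fin 2) K).map σ)ᵀ * J * (t₀ : Matrix (Fin 2) (Fin 2) K) = J)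
    (hsep : (t₀ : Matrix (Fin 2) (Fin 2) K).charpoly.Separable)
    (𝔲 : AddSubgroup (Matrix (Fin 2) (Fin 2) K)) [MeasurableSpace ↥𝔲] [BorelSpace ↥𝔲] [LocallyCompactSpace ↥𝔲]
    (h𝔲 : ∀ X, X ∈ 𝔲 ↔ (X.map σ)ᵀ * J + J * X = 0)
    (L : ↥𝔲 ≃ₜ+ ↥𝔲)
    (hLt : ∀ X : ↥𝔲, (X : Matrix (Fin 2) (Fin 2) K) * (t₀ : Matrix (Fin 2) (Fin 2) K) = (t₀ : Matrix (Fin 2) (Fin 2) K) * X → L X = X)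
    (hLm : ∀ (X : ↥𝔲) (Y : Matrix (Fin 2) (Fin 2) K),
      (X : Matrix (Fin 2) (Fin 2) K) = (t₀ : Matrix (Fin 2) (Fin 2) K) * Y * ((t₀⁻¹ : GL (Fin 2) K) : Matrix (Fin 2) (Fin 2) K) - Y →
      ((L X : ↥𝔲) : Matrix (Fin 2) (Fin 2) K) = ((t₀⁻¹ : GL (Fin 2) K) : Matrix (Fin 2) (Fin 2) K) * X * (t₀ : Matrix (Fin 2) (Fin 2) K) - X) :
    MeasureTheory.addEquivAddHaarChar L =
      NNReal.sqrt (Literature.NumberTheory.GaloisRepresentations.IsNonarchimedeanLocalField.normAbs K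
        (-((t₀ : Matrix (Fin 2) (Fin 2) K).charpoly.discr) / (t₀ : Matrix (Fin 2) (Fin 2) K).det)) := by
  have h2K : (2 : K) ≠ 0 := two_ne_zero
  obtain ⟨F, hF⟩ := F0P3cStCharTSJacCartanFixedField.exists_fixedSubfield σ
  haveI := F0P3cStCharTSJacCartanFixedField.finiteDimensional_of_involutive σ h2K hσ2 F hF
  obtain ⟨𝔲F, h𝔲F⟩ := F0P3cStCharTSJacCartanFixedField.exists_fixedSubmodule_skew σ J F hF
  obtain ⟨_, _, Φ, -, -, -, -, h1, h2⟩ := F0P3cStCharTSCartanDecompositionSkew.exists_cartanLinearPart σ J hJ 𝔲F h𝔲F t₀ ht₀ hsep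
  rw [← NNReal.sqrt_sq (MeasureTheory.addEquivAddHaarChar L),
    F0P3cStCharTSJacCartanWeight.addEquivAddHaarChar_sq_eq_normAbs_det σ hσc hσ2 hσne J hJ hJh t₀ ht₀ hsep 𝔲 h𝔲 L hLt hLm Φ h1 h2,
    det_eq_neg_discr_div_det t₀ hsep Φ h1 h2]

end Weight

end Summit.HodgeConjecture.HodgeConjecture.Cruxes.H413.F0P3cStCharTSAdRegularisedDetTwo

end
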